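import Literature.Geometry.Symplectic.SteinBallHandle
import Literature.Geometry.Symplectic.SteinTwoHandles
import Literature.Topology.FourManifolds.CerfGammaFourProofs
import HarnessLib

/-!
# The `(-2)`-framed Legendrian unknot handle on `B⁴`: an explicit attaching map satisfying the
# hypotheses of Eliashberg's theorem (twisting `-1`)

Topic `Literature/Geometry/Symplectic`; sequel of `SteinBallHandle.lean` (the model attaching map
`unknotAttachingMap : HandleAttachingMap 3 2 B⁴` along the standard Legendrian unknot, whose
handle framing is the Seifert framing: twisting `+1`, defect `2`, outside the hypotheses of
Eliashberg's theorem) and a proofs-only companion of `SteinTwoHandles.lean` (the named fact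
`Gompf1998_thm13_twoHandles`: 2-handles attached to a Stein `W` along Legendrian knots with handle
framing of twisting `-1`, i.e. `tb - 1`, give a Stein `P`).  Here the hypotheses of that fact are
**inhabited by an explicit attaching map**, everything proved:

* `doubleTwist = τ : (x_λ, x_μ) ↦ (x_λ, R(2φ) x_μ)` — rotate the `x_μ`-plane of `ℝ⁴ = ℝ²_λ × ℝ²_μ`
  by twice the angle `φ` of `x_λ` (`cos 2φ = (u₀² - u₁²)/|x_λ|²`, `sin 2φ = 2u₀u₁/|x_λ|²`), with
  inverse `doubleTwistInv`; it preserves `|x_λ|²`, `|x_μ|²`, the norm, is smooth off `x_λ = 0`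
  (`contDiffOn_doubleTwist`), and so restricts to a self-diffeomorphism `doubleTwistDiffeo` of
  Kosinski's tube `T = {x ∈ D⁴ | x_λ ≠ 0}` (`handleTube 3 2`, an open submanifold of the tree's
  closed ball `𝔻⁴`);
* `twistedUnknotAttachingMap : HandleAttachingMap 3 2 B⁴` — `unknotAttachingMap ∘ τ`: still a
  smooth embedding of `T` with open range and `T ∩ ∂D⁴ → ∂B⁴`, with the same attaching circle
  (`attachingCircle_twistedUnknotAttachingMap : … = legendrianUnknot`, as `τ` fixes `S¹ × 0`), but
  with the handle framing turned twice to the left relative to the Seifert framing: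
  `closedBallCoeDeriv_attachingFraming_twisted : Dι ν(θ) = (0, cos 2φ, 0, sin 2φ)` — from
  `dτ_{(θ,0)}(e₂) = (0, 0, cos 2φ, sin 2φ)` (`fderiv_doubleTwist_corePt_single_two`: `τ` is affine
  along the line `(θ, 0) + t e₂`) and the chain rule through the inclusion `B⁴ ↪ ℝ⁴`;
* `twistingLoop_twistedUnknotAttachingMap : (ω(ċ, ν), α(ν)) = (8π sin 2πt, 2 cos 2πt)` — the
  ellipse of `SteinBallLegendrian.lean` traversed *clockwise* — and
  **`twisting_twistedUnknotAttachingMap = -1`** (Rouché comparison with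
  `(4π + 1) i e^{-2πit}`, which winds `-1` times), `defect_twistedUnknotAttachingMap = 0`;
* `isSteinDomain_of_isMultiAttachment_twistedUnknot` — consequently, under
  `Gompf1998_thm13_twoHandles`, every compact `P` which is `B⁴` with a 2-handle attached along
  `twistedUnknotAttachingMap` admits a Stein structure.  (Such a `P` is the disc bundle over `S²`
  of Euler number `-2` — framing `tb - 1 = -2` of the unknot — the unit disc cotangent bundle of
  `S²`, indeed Stein; its existence as an abstract attachment is the named fact
  `HandleAttachingMap.exists_isMultiAttachment`.)

Together with `SteinBallHandle.lean` this pins the framing conventions end to end on the model: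
product framing of the untwisted handle = Seifert framing = twisting `+1` (`tb = -1`); two left
twists = twisting `-1` = the Eliashberg framing.

## References

* R. E. Gompf, *Handlebody construction of Stein surfaces*, Ann. of Math. 148 (1998), §1 (the
  Legendrian unknot, `tb = -1`; "the twist is left-handed") and Thm. 1.3. [Gompf1998]
* S. Akbulut, R. Matveyev, IMRN 1998, §3 (defect). [AkbulutMatveyev1998]
* A. A. Kosinski, *Differential Manifolds* (1993), VI §6. [Kosinski1993]
-/

noncomputable section

open scoped Manifold ContDiff Topology RealInnerProductSpace
open Set Function Metric

namespace Literature.Geometry.Symplectic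

open Literature.Topology.FourManifolds

/-- The model vector space `ℝ⁴` of the tangent spaces. [folklore] -/
local notation "E4" => EuclideanSpace ℝ (Fin 4)
/-- The plane `ℝ²`. [folklore] -/
local notation "E2" => EuclideanSpace ℝ (Fin 2)
/-- The closed unit 4-ball. [folklore] -/
local notation "𝔻⁴" => (Metric.closedBall (0 : EuclideanSpace ℝ (Fin 4)) 1)
/-- Local notation: `𝕊 n` is the unit sphere in `EuclideanSpace ℝ (Fin (n + 1))`. -/
local notation "𝕊 " n:arg => (Metric.sphere (0 : EuclideanSpace ℝ (Fin (n + 1))) 1)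

attribute [local instance] fact_finrank_euclideanSpace_succ

/-! ### The double twist of the `x_μ`-plane along the angle of `x_λ` -/

/-- `cos 2φ = (u₀² - u₁²)/(u₀² + u₁²)` for the angle `φ` of `x_λ = (u₀, u₁)` (junk `0/0` on
`x_λ = 0`). [folklore] -/
def cosTwo (u : E4) : ℝ := (u 0 ^ 2 - u 1 ^ 2) / (u 0 ^ 2 + u 1 ^ 2)

/-- `sin 2φ = 2u₀u₁/(u₀² + u₁²)` for the angle `φ` of `x_λ = (u₀, u₁)`. [folklore] -/
def sinTwo (u : E4) : ℝ := (2 * u 0 * u 1) / (u 0 ^ 2 + u 1 ^ 2)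

/-- `cos² 2φ + sin² 2φ = 1` off `x_λ = 0`. [folklore] -/
theorem cosTwo_sq_add_sinTwo_sq {u : E4} (h : u 0 ^ 2 + u 1 ^ 2 ≠ 0) :
    cosTwo u ^ 2 + sinTwo u ^ 2 = 1 := by
  unfold cosTwo sinTwo
  field_simp
  ring

/-- **The double twist** `τ(x_λ, x_μ) = (x_λ, R(2φ) x_μ)`: rotate the `x_μ`-plane by twice the
angle `φ` of `x_λ` (junk on `x_λ = 0`). [folklore] -/
def doubleTwist (u : E4) : E4 :=
  WithLp.toLp 2 ![u 0, u 1, cosTwo u * u 2 - sinTwo u * u 3, sinTwo u * u 2 + cosTwo u * u 3]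

/-- The inverse double twist `(x_λ, x_μ) ↦ (x_λ, R(-2φ) x_μ)`. [folklore] -/
def doubleTwistInv (u : E4) : E4 :=
  WithLp.toLp 2 ![u 0, u 1, cosTwo u * u 2 + sinTwo u * u 3, -(sinTwo u * u 2) + cosTwo u * u 3]

/-- Coordinate `0` of `τ u`. [folklore] -/
@[simp] theorem doubleTwist_apply_zero (u : E4) : doubleTwist u 0 = u 0 := rfl

/-- Coordinate `1` of `τ u`. [folklore] -/
@[simp] theorem doubleTwist_apply_one (u : E4) : doubleTwist u 1 = u 1 := rfl

/-- Coordinate `2` of `τ u`. [folklore] -/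
@[simp] theorem doubleTwist_apply_two (u : E4) :
    doubleTwist u 2 = cosTwo u * u 2 - sinTwo u * u 3 := rfl

/-- Coordinate `3` of `τ u`. [folklore] -/
@[simp] theorem doubleTwist_apply_three (u : E4) :
    doubleTwist u 3 = sinTwo u * u 2 + cosTwo u * u 3 := rfl

/-- Coordinate `0` of `τ⁻¹ u`. [folklore] -/
@[simp] theorem doubleTwistInv_apply_zero (u : E4) : doubleTwistInv u 0 = u 0 := rfl

/-- Coordinate `1` of `τ⁻¹ u`. [folklore] -/
@[simp] theorem doubleTwistInv_apply_one (u : E4) : doubleTwistInv u 1 = u 1 := rfl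

/-- Coordinate `2` of `τ⁻¹ u`. [folklore] -/
@[simp] theorem doubleTwistInv_apply_two (u : E4) :
    doubleTwistInv u 2 = cosTwo u * u 2 + sinTwo u * u 3 := rfl

/-- Coordinate `3` of `τ⁻¹ u`. [folklore] -/
@[simp] theorem doubleTwistInv_apply_three (u : E4) :
    doubleTwistInv u 3 = -(sinTwo u * u 2) + cosTwo u * u 3 := rfl

/-- `τ` does not change `cos 2φ`. [folklore] -/
@[simp] theorem cosTwo_doubleTwist (u : E4) : cosTwo (doubleTwist u) = cosTwo u := rfl

/-- `τ` does not change `sin 2φ`. [folklore] -/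
@[simp] theorem sinTwo_doubleTwist (u : E4) : sinTwo (doubleTwist u) = sinTwo u := rfl

/-- `τ⁻¹` does not change `cos 2φ`. [folklore] -/
@[simp] theorem cosTwo_doubleTwistInv (u : E4) : cosTwo (doubleTwistInv u) = cosTwo u := rfl

/-- `τ⁻¹` does not change `sin 2φ`. [folklore] -/
@[simp] theorem sinTwo_doubleTwistInv (u : E4) : sinTwo (doubleTwistInv u) = sinTwo u := rfl

/-- `τ⁻¹ ∘ τ = id` off `x_λ = 0`. [folklore] -/
theorem doubleTwistInv_doubleTwist {u : E4} (h : u 0 ^ 2 + u 1 ^ 2 ≠ 0) :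
    doubleTwistInv (doubleTwist u) = u := by
  have hcs := cosTwo_sq_add_sinTwo_sq h
  ext i; fin_cases i
  · rfl
  · rfl
  · simp; linear_combination (u 2) * hcs
  · simp; linear_combination (u 3) * hcs

/-- `τ ∘ τ⁻¹ = id` off `x_λ = 0`. [folklore] -/
theorem doubleTwist_doubleTwistInv {u : E4} (h : u 0 ^ 2 + u 1 ^ 2 ≠ 0) :
    doubleTwist (doubleTwistInv u) = u := by
  have hcs := cosTwo_sq_add_sinTwo_sq h
  ext i; fin_cases i
  · rfl
  · rfl
  · simp; linear_combination (u 2) * hcs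
  · simp; linear_combination (u 3) * hcs

/-- `τ` preserves `|x_λ|²` … [folklore] -/
theorem lamSq_doubleTwist (u : E4) : lamSq 2 (doubleTwist u) = lamSq 2 u := by
  rw [lamSq_two_fin_four, lamSq_two_fin_four]; rfl

/-- … and `τ⁻¹` too. [folklore] -/
theorem lamSq_doubleTwistInv (u : E4) : lamSq 2 (doubleTwistInv u) = lamSq 2 u := by
  rw [lamSq_two_fin_four, lamSq_two_fin_four]; rfl

/-- `τ` preserves `|x_μ|²` (it rotates `x_μ`) … [folklore] -/
theorem muSq_doubleTwist {u : E4} (h : u 0 ^ 2 + u 1 ^ 2 ≠ 0) : muSq 2 (doubleTwist u) = muSq 2 u := by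
  have hcs := cosTwo_sq_add_sinTwo_sq h
  rw [muSq_two_fin_four, muSq_two_fin_four, doubleTwist_apply_two, doubleTwist_apply_three]
  linear_combination (u 2 ^ 2 + u 3 ^ 2) * hcs

/-- … and `τ⁻¹` too. [folklore] -/
theorem muSq_doubleTwistInv {u : E4} (h : u 0 ^ 2 + u 1 ^ 2 ≠ 0) :
    muSq 2 (doubleTwistInv u) = muSq 2 u := by
  have hcs := cosTwo_sq_add_sinTwo_sq h
  rw [muSq_two_fin_four, muSq_two_fin_four, doubleTwistInv_apply_two, doubleTwistInv_apply_three]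
  linear_combination (u 2 ^ 2 + u 3 ^ 2) * hcs

/-- `τ` preserves the norm … [folklore] -/
theorem norm_doubleTwist {u : E4} (h : u 0 ^ 2 + u 1 ^ 2 ≠ 0) : ‖doubleTwist u‖ = ‖u‖ := by
  have h1 := lamSq_add_muSq 2 (doubleTwist u)
  rw [lamSq_doubleTwist, muSq_doubleTwist h, lamSq_add_muSq] at h1
  have := sq_eq_sq₀ (norm_nonneg u) (norm_nonneg (doubleTwist u)) |>.1 h1
  exact this.symm

/-- … and `τ⁻¹` too. [folklore] -/
theorem norm_doubleTwistInv {u : E4} (h : u 0 ^ 2 + u 1 ^ 2 ≠ 0) : ‖doubleTwistInv u‖ = ‖u‖ := by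
  have h1 := lamSq_add_muSq 2 (doubleTwistInv u)
  rw [lamSq_doubleTwistInv, muSq_doubleTwistInv h, lamSq_add_muSq] at h1
  have := sq_eq_sq₀ (norm_nonneg u) (norm_nonneg (doubleTwistInv u)) |>.1 h1
  exact this.symm

/-- The domain `{x_λ ≠ 0}` of smoothness of the twists. [folklore] -/
def twistDomain : Set E4 := {u | u 0 ^ 2 + u 1 ^ 2 ≠ 0}

/-- `{x_λ ≠ 0}` is open. [folklore] -/
theorem isOpen_twistDomain : IsOpen twistDomain :=
  isOpen_ne.preimage (by fun_prop)

/-- `cos 2φ` is smooth off `x_λ = 0`. [folklore] -/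
theorem contDiffOn_cosTwo : ContDiffOn ℝ ∞ cosTwo twistDomain := by
  unfold cosTwo
  exact ContDiffOn.div (by fun_prop) (by fun_prop) fun u hu => hu

/-- `sin 2φ` is smooth off `x_λ = 0`. [folklore] -/
theorem contDiffOn_sinTwo : ContDiffOn ℝ ∞ sinTwo twistDomain := by
  unfold sinTwo
  exact ContDiffOn.div (by fun_prop) (by fun_prop) fun u hu => hu

/-- **The double twist is smooth off `x_λ = 0`.** [folklore] -/
theorem contDiffOn_doubleTwist : ContDiffOn ℝ ∞ doubleTwist twistDomain := by
  rw [contDiffOn_euclidean]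
  intro i
  fin_cases i
  · show ContDiffOn ℝ ∞ (fun u : E4 => u 0) twistDomain; fun_prop
  · show ContDiffOn ℝ ∞ (fun u : E4 => u 1) twistDomain; fun_prop
  · show ContDiffOn ℝ ∞ (fun u : E4 => cosTwo u * u 2 - sinTwo u * u 3) twistDomain
    exact (contDiffOn_cosTwo.mul (by fun_prop)).sub (contDiffOn_sinTwo.mul (by fun_prop))
  · show ContDiffOn ℝ ∞ (fun u : E4 => sinTwo u * u 2 + cosTwo u * u 3) twistDomain
    exact (contDiffOn_sinTwo.mul (by fun_prop)).add (contDiffOn_cosTwo.mul (by fun_prop))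

/-- The inverse double twist is smooth off `x_λ = 0`. [folklore] -/
theorem contDiffOn_doubleTwistInv : ContDiffOn ℝ ∞ doubleTwistInv twistDomain := by
  rw [contDiffOn_euclidean]
  intro i
  fin_cases i
  · show ContDiffOn ℝ ∞ (fun u : E4 => u 0) twistDomain; fun_prop
  · show ContDiffOn ℝ ∞ (fun u : E4 => u 1) twistDomain; fun_prop
  · show ContDiffOn ℝ ∞ (fun u : E4 => cosTwo u * u 2 + sinTwo u * u 3) twistDomain
    exact (contDiffOn_cosTwo.mul (by fun_prop)).add (contDiffOn_sinTwo.mul (by fun_prop))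
  · show ContDiffOn ℝ ∞ (fun u : E4 => -(sinTwo u * u 2) + cosTwo u * u 3) twistDomain
    exact (contDiffOn_sinTwo.mul (by fun_prop)).neg.add (contDiffOn_cosTwo.mul (by fun_prop))

/-! ### The double twist as a self-diffeomorphism of Kosinski's tube `T ⊆ D⁴` -/

/-- Points of `T` have `x_λ ≠ 0` in coordinates. [folklore] -/
theorem coe_mem_twistDomain (y : ↥(handleTube 3 2)) : ((y : 𝔻⁴) : E4) ∈ twistDomain := by
  have h := y.2
  rw [mem_handleTube, lamSq_two_fin_four] at h
  exact h

/-- The coordinate map `T → ℝ⁴` is smooth. [folklore] -/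
theorem contMDiff_coe_coe_handleTube :
    ContMDiff (𝓡∂ 4) 𝓘(ℝ, E4) ∞ (fun y : ↥(handleTube 3 2) => ((y : 𝔻⁴) : E4)) :=
  contMDiff_coe_closedBall.comp contMDiff_subtype_val

/-- `τ` on a point of `T`, as a point of `T`. [folklore] -/
def doubleTwistPt (y : ↥(handleTube 3 2)) : ↥(handleTube 3 2) :=
  ⟨⟨doubleTwist ((y : 𝔻⁴) : E4), by
      rw [mem_closedBall_zero_iff, norm_doubleTwist (coe_mem_twistDomain y)]
      exact mem_closedBall_zero_iff.1 (y : 𝔻⁴).2⟩, by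
      rw [mem_handleTube]
      show lamSq 2 (doubleTwist ((y : 𝔻⁴) : E4)) ≠ 0
      rw [lamSq_doubleTwist]; exact y.2⟩

/-- `τ⁻¹` on a point of `T`, as a point of `T`. [folklore] -/
def doubleTwistInvPt (y : ↥(handleTube 3 2)) : ↥(handleTube 3 2) :=
  ⟨⟨doubleTwistInv ((y : 𝔻⁴) : E4), by
      rw [mem_closedBall_zero_iff, norm_doubleTwistInv (coe_mem_twistDomain y)]
      exact mem_closedBall_zero_iff.1 (y : 𝔻⁴).2⟩, by
      rw [mem_handleTube]
      show lamSq 2 (doubleTwistInv ((y : 𝔻⁴) : E4)) ≠ 0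
      rw [lamSq_doubleTwistInv]; exact y.2⟩

/-- The underlying vector of `doubleTwistPt y` is `τ y`. [folklore] -/
@[simp] theorem coe_coe_doubleTwistPt (y : ↥(handleTube 3 2)) :
    (((doubleTwistPt y : ↥(handleTube 3 2)) : 𝔻⁴) : E4) = doubleTwist ((y : 𝔻⁴) : E4) := rfl

/-- The underlying vector of `doubleTwistInvPt y` is `τ⁻¹ y`. [folklore] -/
@[simp] theorem coe_coe_doubleTwistInvPt (y : ↥(handleTube 3 2)) :
    (((doubleTwistInvPt y : ↥(handleTube 3 2)) : 𝔻⁴) : E4) = doubleTwistInv ((y : 𝔻⁴) : E4) := rfl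

/-- Smoothness of `τ : T → T`. [folklore] -/
theorem contMDiff_doubleTwistPt : ContMDiff (𝓡∂ 4) (𝓡∂ 4) ∞ doubleTwistPt := by
  rw [← ContMDiff.subtypeVal_comp_iff]
  have h1 : ContMDiff (𝓡∂ 4) 𝓘(ℝ, E4) ∞ (fun y : ↥(handleTube 3 2) => doubleTwist ((y : 𝔻⁴) : E4)) :=
    (contMDiffOn_iff_contDiffOn.2 contDiffOn_doubleTwist).comp_contMDiff contMDiff_coe_coe_handleTube
      coe_mem_twistDomain
  exact ContMDiff.codRestrict_closedBall h1 _

/-- Smoothness of `τ⁻¹ : T → T`. [folklore] -/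
theorem contMDiff_doubleTwistInvPt : ContMDiff (𝓡∂ 4) (𝓡∂ 4) ∞ doubleTwistInvPt := by
  rw [← ContMDiff.subtypeVal_comp_iff]
  have h1 : ContMDiff (𝓡∂ 4) 𝓘(ℝ, E4) ∞
      (fun y : ↥(handleTube 3 2) => doubleTwistInv ((y : 𝔻⁴) : E4)) :=
    (contMDiffOn_iff_contDiffOn.2 contDiffOn_doubleTwistInv).comp_contMDiff
      contMDiff_coe_coe_handleTube coe_mem_twistDomain
  exact ContMDiff.codRestrict_closedBall h1 _

/-- **The double twist as a self-diffeomorphism of `T`.** [folklore] -/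
def doubleTwistDiffeo : ↥(handleTube 3 2) ≃ₘ⟮𝓡∂ 4, 𝓡∂ 4⟯ ↥(handleTube 3 2) where
  toFun := doubleTwistPt
  invFun := doubleTwistInvPt
  left_inv y := by
    apply Subtype.ext; apply Subtype.ext
    show doubleTwistInv (doubleTwist ((y : 𝔻⁴) : E4)) = ((y : 𝔻⁴) : E4)
    exact doubleTwistInv_doubleTwist (coe_mem_twistDomain y)
  right_inv y := by
    apply Subtype.ext; apply Subtype.ext
    show doubleTwist (doubleTwistInv ((y : 𝔻⁴) : E4)) = ((y : 𝔻⁴) : E4)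
    exact doubleTwist_doubleTwistInv (coe_mem_twistDomain y)
  contMDiff_toFun := contMDiff_doubleTwistPt
  contMDiff_invFun := contMDiff_doubleTwistInvPt

/-- `doubleTwistDiffeo` acts by `doubleTwistPt`. [folklore] -/
@[simp] theorem doubleTwistDiffeo_apply (y : ↥(handleTube 3 2)) : doubleTwistDiffeo y = doubleTwistPt y := rfl

/-! ### The `(-2)`-framed attaching map along the Legendrian unknot -/

/-- **The attaching map of a 2-handle on `B⁴` along the standard Legendrian unknot with framing
`tb - 1 = -2`**: Kosinski's tube `T` precomposed with the double twist `τ` and mapped into `B⁴`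
by the swap `x₁ ↔ x₂` (`unknotAttachingMap ∘ τ`). [cite: Kosinski1993, VI §6] -/
def twistedUnknotAttachingMap : HandleAttachingMap 3 2 (𝔻⁴) where
  toFun y := closedBallCongr swapOneTwo ((doubleTwistDiffeo y : ↥(handleTube 3 2)) : 𝔻⁴)
  isSmoothEmbedding :=
    Manifold.IsSmoothEmbedding.comp_diffeomorph doubleTwistDiffeo
      ((Manifold.IsSmoothEmbedding.of_opens (I := 𝓡∂ 4) (n := ∞) (handleTube 3 2)).diffeomorph_comp
        (closedBallCongr swapOneTwo))
  isOpen_range := by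
    have hs : Function.Surjective (fun y : ↥(handleTube 3 2) => doubleTwistDiffeo y) :=
      doubleTwistDiffeo.surjective
    rw [show (fun y : ↥(handleTube 3 2) =>
        closedBallCongr swapOneTwo ((doubleTwistDiffeo y : ↥(handleTube 3 2)) : 𝔻⁴)) =
        (fun y : ↥(handleTube 3 2) => closedBallCongr swapOneTwo (y : 𝔻⁴)) ∘
          (fun y : ↥(handleTube 3 2) => doubleTwistDiffeo y) from rfl,
      hs.range_comp]
    exact unknotAttachingMap.isOpen_range
  isBoundaryPoint y hy := by
    rw [isBoundaryPoint_iff_norm_eq_one, coe_closedBallCongr, LinearIsometryEquiv.norm_map,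
      doubleTwistDiffeo_apply, coe_coe_doubleTwistPt, norm_doubleTwist (coe_mem_twistDomain y)]
    exact hy

/-- Unfolding `twistedUnknotAttachingMap`. [folklore] -/
theorem twistedUnknotAttachingMap_apply (y : ↥(handleTube 3 2)) :
    twistedUnknotAttachingMap.toFun y = closedBallCongr swapOneTwo ((doubleTwistPt y : ↥(handleTube 3 2)) : 𝔻⁴) :=
  rfl

/-- The underlying vector of `twistedUnknotAttachingMap y` is `σ (τ y)`. [folklore] -/
theorem coe_twistedUnknotAttachingMap_apply (y : ↥(handleTube 3 2)) :
    ((twistedUnknotAttachingMap.toFun y : 𝔻⁴) : E4) = swapOneTwo (doubleTwist ((y : 𝔻⁴) : E4)) := rfl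

/-- The double twist fixes the attaching circle `S¹ × 0` pointwise. [folklore] -/
theorem doubleTwist_corePt (θ : 𝕊 1) : doubleTwist (corePt θ) = corePt θ := by
  ext i; fin_cases i <;> simp

/-- **The attaching circle of the twisted attaching map is still the standard Legendrian unknot.**
[folklore] -/
theorem attachingCircle_twistedUnknotAttachingMap :
    twistedUnknotAttachingMap.attachingCircle = legendrianUnknot := by
  funext θ
  apply Subtype.ext
  show swapOneTwo (doubleTwist (corePt θ)) = realPlaneLin (θ : E2)
  rw [doubleTwist_corePt]; exact swapOneTwo_corePt θ

/-- The twisted attaching map sends the model circle point over `θ` to `legendrianUnknot θ`.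
[folklore] -/
theorem twistedUnknotAttachingMap_coreTubePt (θ : 𝕊 1) :
    twistedUnknotAttachingMap.toFun (coreTubePt θ) = legendrianUnknot θ := by
  have := congrFun attachingCircle_twistedUnknotAttachingMap θ
  exact this

/-! ### The framing of the twisted attaching map: `Dι ν = (0, cos 2φ, 0, sin 2φ)` -/

/-- The direction `dτ(e₂) = (0, 0, cos 2φ, sin 2φ)` at a point of the attaching circle. [folklore] -/
def twistDir (p : E4) : E4 := WithLp.toLp 2 ![0, 0, cosTwo p, sinTwo p]

/-- Along the line `p + t e₂` through a point `p` of the attaching circle (`p₂ = p₃ = 0`) the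
double twist is affine: `τ(p + t e₂) = p + t dτ(e₂)`. [folklore] -/
theorem doubleTwist_corePt_add_smul (θ : 𝕊 1) (t : ℝ) :
    doubleTwist (corePt θ + t • EuclideanSpace.single (2 : Fin 4) (1 : ℝ)) =
      corePt θ + t • twistDir (corePt θ) := by
  ext i; fin_cases i <;> simp [twistDir, cosTwo, sinTwo, mul_comm]

/-- The double twist is differentiable at the points of the attaching circle. [folklore] -/
theorem differentiableAt_doubleTwist_corePt (θ : 𝕊 1) : DifferentiableAt ℝ doubleTwist (corePt θ) := by
  have hmem : corePt θ ∈ twistDomain := by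
    show corePt θ 0 ^ 2 + corePt θ 1 ^ 2 ≠ 0
    rw [← lamSq_two_fin_four, lamSq_corePt]; exact one_ne_zero
  exact (contDiffOn_doubleTwist.differentiableOn (by simp)).differentiableAt
    (isOpen_twistDomain.mem_nhds hmem)

/-- **`dτ_p(e₂) = (0, 0, cos 2φ, sin 2φ)`** at `p = (θ, 0)`. [folklore] -/
theorem fderiv_doubleTwist_corePt_single_two (θ : 𝕊 1) :
    fderiv ℝ doubleTwist (corePt θ) (EuclideanSpace.single (2 : Fin 4) (1 : ℝ)) = twistDir (corePt θ) := by
  have hline : HasDerivAt (fun t : ℝ => corePt θ + t • EuclideanSpace.single (2 : Fin 4) (1 : ℝ))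
      (EuclideanSpace.single (2 : Fin 4) (1 : ℝ)) 0 := by
    simpa using ((hasDerivAt_id (0 : ℝ)).smul_const (EuclideanSpace.single (2 : Fin 4) (1 : ℝ))).const_add
      (corePt θ)
  have h1 : HasDerivAt (fun t : ℝ => doubleTwist (corePt θ + t • EuclideanSpace.single (2 : Fin 4) (1 : ℝ)))
      (fderiv ℝ doubleTwist (corePt θ) (EuclideanSpace.single (2 : Fin 4) (1 : ℝ))) 0 := by
    have hd := (differentiableAt_doubleTwist_corePt θ).hasFDerivAt
    have h0 : corePt θ = corePt θ + (0 : ℝ) • EuclideanSpace.single (2 : Fin 4) (1 : ℝ) := by simp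
    exact hd.comp_hasDerivAt_of_eq (0 : ℝ) hline h0
  have h2 : HasDerivAt (fun t : ℝ => doubleTwist (corePt θ + t • EuclideanSpace.single (2 : Fin 4) (1 : ℝ)))
      (twistDir (corePt θ)) 0 := by
    have h := ((hasDerivAt_id (0 : ℝ)).smul_const (twistDir (corePt θ))).const_add (corePt θ)
    simp only [one_smul] at h
    refine h.congr_of_eventuallyEq (Filter.Eventually.of_forall fun t => ?_)
    exact doubleTwist_corePt_add_smul θ t
  exact h1.unique h2

/-- **The differential of the twisted attaching map, read ambiently, on the framing direction**:
`Dι (ν(θ)) = σ (dτ(e₂)) = (0, cos 2φ, 0, sin 2φ)`. [folklore] -/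
theorem closedBallCoeDeriv_attachingFraming_twisted (θ : 𝕊 1) :
    closedBallCoeDeriv (legendrianUnknot θ) (twistedUnknotAttachingMap.attachingFraming θ) =
      swapOneTwo (twistDir (corePt θ)) := by
  -- two computations of the derivative of `y ↦ ι(h̄ y) = σ (τ (ι y))` at `y = (θ, 0)`
  have hfun : ((Subtype.val : 𝔻⁴ → E4) ∘ twistedUnknotAttachingMap.toFun) =
      fun y : ↥(handleTube 3 2) => swapOneTwo (doubleTwist (((y : 𝔻⁴) : E4))) := rfl
  have hτ : HasFDerivAt doubleTwist (fderiv ℝ doubleTwist (corePt θ))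
      ((((coreTubePt θ : ↥(handleTube 3 2)) : 𝔻⁴) : E4)) :=
    (differentiableAt_doubleTwist_corePt θ).hasFDerivAt
  have h1 : HasMFDerivAt (𝓡∂ 4) 𝓘(ℝ, E4)
      (fun y : ↥(handleTube 3 2) => swapOneTwo (doubleTwist (((y : 𝔻⁴) : E4)))) (coreTubePt θ)
      (((swapOneTwo.toContinuousLinearEquiv : E4 →L[ℝ] E4).comp (fderiv ℝ doubleTwist (corePt θ))).comp
        (closedBallCoeDeriv ((coreTubePt θ : ↥(handleTube 3 2)) : 𝔻⁴) : E4 →L[ℝ] E4)) := by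
    have h := (((swapOneTwo.toContinuousLinearEquiv : E4 →L[ℝ] E4).hasFDerivAt.comp _ hτ).hasMFDerivAt).comp
      ((coreTubePt θ : ↥(handleTube 3 2)) : 𝔻⁴)
      (hasMFDerivAt_coe_closedBall ((coreTubePt θ : ↥(handleTube 3 2)) : 𝔻⁴))
    exact hasMFDerivAt_restrict_opens (handleTube 3 2)
      (f := fun x : 𝔻⁴ => swapOneTwo (doubleTwist (x : E4))) h
  have hd : MDifferentiableAt (𝓡∂ 4) (𝓡∂ 4) twistedUnknotAttachingMap.toFun (coreTubePt θ) :=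
    (twistedUnknotAttachingMap.isSmoothEmbedding.contMDiff (coreTubePt θ)).mdifferentiableAt (by simp)
  have h2 : HasMFDerivAt (𝓡∂ 4) 𝓘(ℝ, E4) ((Subtype.val : 𝔻⁴ → E4) ∘ twistedUnknotAttachingMap.toFun)
      (coreTubePt θ)
      ((closedBallCoeDeriv (twistedUnknotAttachingMap.toFun (coreTubePt θ)) : E4 →L[ℝ] E4).comp
        (mfderiv (𝓡∂ 4) (𝓡∂ 4) twistedUnknotAttachingMap.toFun (coreTubePt θ))) :=
    (hasMFDerivAt_coe_closedBall (twistedUnknotAttachingMap.toFun (coreTubePt θ))).comp (coreTubePt θ)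
      hd.hasMFDerivAt
  rw [hfun] at h2
  have hc : (((closedBallCoeDeriv (twistedUnknotAttachingMap.toFun (coreTubePt θ)) : E4 →L[ℝ] E4).comp
      (mfderiv (𝓡∂ 4) (𝓡∂ 4) twistedUnknotAttachingMap.toFun (coreTubePt θ))) : E4 →L[ℝ] E4) =
      ((swapOneTwo.toContinuousLinearEquiv : E4 →L[ℝ] E4).comp (fderiv ℝ doubleTwist (corePt θ))).comp
        (closedBallCoeDeriv ((coreTubePt θ : ↥(handleTube 3 2)) : 𝔻⁴) : E4 →L[ℝ] E4) :=
    h2.mfderiv.symm.trans h1.mfderiv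
  have hv := congrArg (fun L : E4 →L[ℝ] E4 =>
    L ((closedBallCoeDeriv ((coreTubePt θ : ↥(handleTube 3 2)) : 𝔻⁴)).symm
      (EuclideanSpace.single (2 : Fin 4) (1 : ℝ)))) hc
  simp only [ContinuousLinearMap.comp_apply, ContinuousLinearEquiv.coe_coe,
    ContinuousLinearEquiv.apply_symm_apply, LinearIsometryEquiv.coe_toContinuousLinearEquiv] at hv
  rw [twistedUnknotAttachingMap_coreTubePt, fderiv_doubleTwist_corePt_single_two] at hv
  exact hv

/-- Coordinates of `Dι ν`: `(0, cos 2φ, 0, sin 2φ)`. [folklore] -/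
theorem swapOneTwo_twistDir (p : E4) :
    swapOneTwo (twistDir p) = WithLp.toLp 2 ![0, cosTwo p, 0, sinTwo p] := by
  ext i; fin_cases i <;> simp [twistDir]

/-- On the unit circle `cos 2φ` and `sin 2φ` of the unit-period parametrisation. [folklore] -/
theorem cosTwo_corePt_circlePt (t : ℝ) :
    cosTwo (corePt (circlePt t)) = Real.cos (2 * Real.pi * t) ^ 2 - Real.sin (2 * Real.pi * t) ^ 2 := by
  have h := Real.sin_sq_add_cos_sq (2 * Real.pi * t)
  simp only [cosTwo, corePt_apply_zero, corePt_apply_one, circlePt_apply_zero, circlePt_apply_one]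
  rw [show Real.cos (2 * Real.pi * t) ^ 2 + Real.sin (2 * Real.pi * t) ^ 2 = 1 by linarith, div_one]

/-- `sin 2φ` on the unit-period parametrisation. [folklore] -/
theorem sinTwo_corePt_circlePt (t : ℝ) :
    sinTwo (corePt (circlePt t)) = 2 * Real.cos (2 * Real.pi * t) * Real.sin (2 * Real.pi * t) := by
  have h := Real.sin_sq_add_cos_sq (2 * Real.pi * t)
  simp only [sinTwo, corePt_apply_zero, corePt_apply_one, circlePt_apply_zero, circlePt_apply_one]
  rw [show Real.cos (2 * Real.pi * t) ^ 2 + Real.sin (2 * Real.pi * t) ^ 2 = 1 by linarith, div_one]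

/-! ### The twisting number is `-1`: the hypotheses of Eliashberg's theorem hold -/

/-- **The twisting loop of the twisted framing**: `t ↦ (8π sin 2πt, 2 cos 2πt)`, traversed
clockwise. [folklore] -/
theorem twistingLoop_twistedUnknotAttachingMap (t : ℝ) :
    steinStructureClosedBall.twistingLoop legendrianUnknot twistedUnknotAttachingMap.attachingFraming t =
      ⟨8 * Real.pi * Real.sin (2 * Real.pi * t), 2 * Real.cos (2 * Real.pi * t)⟩ := by
  have hsc := Real.sin_sq_add_cos_sq (2 * Real.pi * t)
  rw [SteinStructure.twistingLoop_apply, kahlerForm_steinStructureClosedBall,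
    contactForm_steinStructureClosedBall, closedBallCoeDeriv_attachingFraming_twisted,
    closedBallCoeDeriv_knotVelocity_legendrianUnknot, swapOneTwo_twistDir, cosTwo_corePt_circlePt,
    sinTwo_corePt_circlePt, coe_legendrianUnknot, inner_fin_four, inner_fin_four]
  apply Complex.ext
  · simp [unknotVelocityAmb]
    linear_combination (8 * Real.pi * Real.sin (2 * Real.pi * t)) * hsc
  · simp
    linear_combination (Real.cos (2 * Real.pi * t)) * hsc

/-- The comparison loop `t ↦ i (4π + 1) e^{-2πit}` winds `-1` times about `0`. [folklore] -/
theorem wind_I_mul_circleLoop_inv :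
    Literature.Topology.PlaneTopology.wind
        (fun t => ((4 * Real.pi + 1 : ℝ) : ℂ) * Complex.I *
          (Literature.Topology.PlaneTopology.circleLoop 0 1 t)⁻¹) = -1 := by
  have hR : (0 : ℝ) < 4 * Real.pi + 1 := by positivity
  have hK : Literature.Topology.PlaneTopology.IsNonvanishingLoop
      fun _ : ℝ => ((4 * Real.pi + 1 : ℝ) : ℂ) * Complex.I :=
    Literature.Topology.PlaneTopology.IsNonvanishingLoop.const
      (mul_ne_zero (by exact_mod_cast hR.ne') Complex.I_ne_zero)
  have hC : Literature.Topology.PlaneTopology.IsNonvanishingLoop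
      (Literature.Topology.PlaneTopology.circleLoop 0 1) :=
    Literature.Topology.PlaneTopology.isNonvanishingLoop_circleLoop (by simp)
  rw [Literature.Topology.PlaneTopology.wind_mul hK hC.inv, Literature.Topology.PlaneTopology.wind_const,
    Literature.Topology.PlaneTopology.wind_inv hC,
    Literature.Topology.PlaneTopology.wind_circleLoop_zero one_pos]
  norm_num

/-- **The framing of the twisted attaching map has twisting number `-1`** ("framing `tb - 1`",
one left twist added to the canonical framing). [cite: Gompf1998, Thm. 1.3] -/
theorem twisting_twistedUnknotAttachingMap :
    steinStructureClosedBall.twisting twistedUnknotAttachingMap.attachingCircle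
      twistedUnknotAttachingMap.attachingFraming = -1 := by
  rw [attachingCircle_twistedUnknotAttachingMap]
  unfold SteinStructure.twisting
  have hfun : steinStructureClosedBall.twistingLoop legendrianUnknot
      twistedUnknotAttachingMap.attachingFraming = fun t : ℝ =>
        (⟨8 * Real.pi * Real.sin (2 * Real.pi * t), 2 * Real.cos (2 * Real.pi * t)⟩ : ℂ) :=
    funext twistingLoop_twistedUnknotAttachingMap
  rw [hfun, ← wind_I_mul_circleLoop_inv]
  have hR : (0 : ℝ) < 4 * Real.pi + 1 := by positivity
  have hC : Literature.Topology.PlaneTopology.IsNonvanishingLoop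
      (Literature.Topology.PlaneTopology.circleLoop 0 1) :=
    Literature.Topology.PlaneTopology.isNonvanishingLoop_circleLoop (by simp)
  have hg : Literature.Topology.PlaneTopology.IsNonvanishingLoop
      (fun t => ((4 * Real.pi + 1 : ℝ) : ℂ) * Complex.I *
        (Literature.Topology.PlaneTopology.circleLoop 0 1 t)⁻¹) :=
    (Literature.Topology.PlaneTopology.IsNonvanishingLoop.const
      (mul_ne_zero (by exact_mod_cast hR.ne') Complex.I_ne_zero)).mul hC.inv
  refine Literature.Topology.PlaneTopology.wind_eq_of_norm_sub_lt
    (continuous_complex_mk (by fun_prop) (by fun_prop)).continuousOn ?_ hg ?_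
  · apply Complex.ext <;> simp
  · intro t _
    have hexp : (Literature.Topology.PlaneTopology.circleLoop 0 1 t)⁻¹ =
        ⟨Real.cos (2 * Real.pi * t), -Real.sin (2 * Real.pi * t)⟩ := by
      rw [Literature.Topology.PlaneTopology.circleLoop_apply, zero_add, Complex.ofReal_one, one_mul,
        ← Complex.exp_neg]
      apply Complex.ext
      · simp [Complex.exp_re, mul_comm]
      · simp [Complex.exp_im, mul_comm]
    have hg' : ((4 * Real.pi + 1 : ℝ) : ℂ) * Complex.I * (Literature.Topology.PlaneTopology.circleLoop 0 1 t)⁻¹ =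
        ⟨(4 * Real.pi + 1) * Real.sin (2 * Real.pi * t), (4 * Real.pi + 1) * Real.cos (2 * Real.pi * t)⟩ := by
      rw [hexp]
      apply Complex.ext
      · simp
      · simp
    rw [hg']
    have hπ : (2 : ℝ) ≤ Real.pi := Real.two_le_pi
    have hsc := Real.sin_sq_add_cos_sq (2 * Real.pi * t)
    have hn1 : ‖((⟨8 * Real.pi * Real.sin (2 * Real.pi * t), 2 * Real.cos (2 * Real.pi * t)⟩ : ℂ) -
        ⟨(4 * Real.pi + 1) * Real.sin (2 * Real.pi * t), (4 * Real.pi + 1) * Real.cos (2 * Real.pi * t)⟩)‖ =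
          4 * Real.pi - 1 := by
      rw [Complex.norm_def, Complex.normSq_apply]
      rw [Real.sqrt_eq_iff_mul_self_eq_of_pos (by linarith)]
      simp; nlinarith [hsc]
    have hn2 : ‖((⟨(4 * Real.pi + 1) * Real.sin (2 * Real.pi * t),
        (4 * Real.pi + 1) * Real.cos (2 * Real.pi * t)⟩ : ℂ))‖ = 4 * Real.pi + 1 := by
      rw [Complex.norm_def, Complex.normSq_apply]
      rw [Real.sqrt_eq_iff_mul_self_eq_of_pos (by linarith)]
      simp; nlinarith [hsc]
    rw [hn1, hn2]; linarith

/-- Hence **defect `0`**. [cite: AkbulutMatveyev1998, §3] -/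
theorem defect_twistedUnknotAttachingMap :
    steinStructureClosedBall.defect twistedUnknotAttachingMap.attachingCircle
      twistedUnknotAttachingMap.attachingFraming = 0 := by
  rw [SteinStructure.defect, twisting_twistedUnknotAttachingMap]; rfl

/-- **The attaching circle of the twisted attaching map is a Legendrian knot.**
[cite: Gompf1998, §1] -/
theorem isLegendrianKnot_attachingCircle_twistedUnknotAttachingMap :
    IsLegendrianKnot steinStructureClosedBall.J twistedUnknotAttachingMap.attachingCircle := by
  rw [attachingCircle_twistedUnknotAttachingMap]; exact isLegendrianKnot_legendrianUnknot

/-- **Eliashberg's theorem applies to the `(-2)`-framed Legendrian unknot**: under the named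
fact `Gompf1998_thm13_twoHandles`, every compact `P` which is `B⁴` with a 2-handle attached along
`twistedUnknotAttachingMap` (the disc bundle over `S²` of Euler number `-2`, the unit disc
cotangent bundle of `S²`) admits a Stein structure.  This exhibits the hypotheses of that fact as
satisfiable by an explicit attaching map. [cite: Gompf1998, Thm. 1.3] -/
theorem isSteinDomain_of_isMultiAttachment_twistedUnknot (hE : Gompf1998_thm13_twoHandles)
    {P : Type} [TopologicalSpace P] [ChartedSpace (EuclideanHalfSpace 4) P] [IsManifold (𝓡∂ 4) ∞ P]
    [CompactSpace P]
    (hP : HandleAttachingMap.IsMultiAttachment (fun _ : Unit => twistedUnknotAttachingMap) (𝓡∂ 4) P) :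
    IsSteinDomain P :=
  hE.single steinStructureClosedBall twistedUnknotAttachingMap hP
    isLegendrianKnot_attachingCircle_twistedUnknotAttachingMap twisting_twistedUnknotAttachingMap

end Literature.Geometry.Symplectic

end
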